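import Literature.RepresentationTheory.FiniteGroups.StableLatticeReductionInvariantInt
import HarnessLib

/-!
# A counting form of "uniserial filtration": an equivariant nilpotent operator `T` with `Tⁿ = 0`
# and `#F = #(ker T)ⁿ` gives `ψ(F) = n • ψ(ker T)` for every additive invariant `ψ`
# (the `p`-part step of Tate's Euler–Poincaré characteristic argument, Milne ADT I §2/§5)

Topic `RepresentationTheory/FiniteGroups`; namespace `Literature.RepresentationTheory.FiniteGroups`
(sub-namespace `KernelFiltration`).  THEOREMS ONLY (no definition, no named fact, no `sorry`, no
instance).  Sequel of `StableLatticeReductionInvariantInt` (the `(ψ, hψ)` calculus of an invariant of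
`ℤ[G]`-modules additive on short exact sequences with FINITE middle term KILLED BY `p`).

In Tate's proof of the global Euler–Poincaré characteristic formula (J. S. Milne, *Arithmetic
Duality Theorems* (2006), I Thm. 5.1, proof p. 70, with Lemma 2.10 p. 32: "we can assume that `Ḡ`
is a cyclic group of order prime to `p`") the cyclic subgroups of `p`-power index make no
contribution because, for a group acting through a cyclic group `P` of order `p`, the module
`𝔽_p[P] = 𝔽_p[t]/(t − 1)^p` is uniserial: the kernels `K_i = ker (t − 1)^i` filter it with all
graded pieces the trivial module (J.-P. Serre, *Local Fields* IX §1, Thm. 2 and Cor.).  The lane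
«TATE-EPC-TC» (road memo `TATE-EPC-TC-ROAD`, evidence #54 on stmt-BirchSwinnertonDyer-19032) needs
this at the level of the AMBIENT finite group `Q ⊇ P` acting on `M`-valued functions on `Q/C`
(brick B9, the `p`-part step), where no `p`-group quotient is available; what survives is the
following module-theoretic statement, proved here by COUNTING instead of by structure theory:

> **`additive_eq_smul_of_pow_eq_zero_of_card`.**  Let `F` be a finite `ℤ[G]`-module killed by the
> prime `p`, `T` a `G`-equivariant endomorphism of `F` with `T ^ n = 0` and
> `Nat.card F = (Nat.card (ker T)) ^ n`.  Then `ψ F = n • ψ (ker T)`.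

Proof.  `K i := ker (T ^ i)` is a `G`-stable chain `0 = K₀ ≤ K₁ ≤ ⋯ ≤ Kₙ = F`, and `T` maps
`K (i+1)` to `K i` with kernel `K 1`; hence `#K(i+1) = #K₁ · #T(K(i+1)) ≤ #K₁ · #K i`, so
`#K i ≤ #K₁ ^ i`, and the hypothesis `#Kₙ = #F = #K₁ ^ n` forces equality all the way down, i.e.
`T : K(i+1) → K i` is SURJECTIVE for `i < n` (§2).  Additivity along
`0 → K₁ → K(i+1) → K i → 0` then gives `ψ (K i) = i • ψ K₁` (§3).

## References
* J. S. Milne, *Arithmetic Duality Theorems*, 2nd ed. (2006), I Lemma 2.10 (p. 32) and the proof of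
  Thm. 5.1 (p. 70). [MilneADT2006]
* J.-P. Serre, *Local Fields*, GTM 67 (1979), IX §1 Thm. 2, Corollary. [Serre1979]
* J.-P. Serre, *Linear Representations of Finite Groups*, GTM 42 (1977), §15.2 Thm. 32 (the
  additive-invariant calculus). [SerreLinearRepresentations1977]
-/

universe u

namespace Literature.RepresentationTheory.FiniteGroups

namespace KernelFiltration

open Function LinearMap Submodule StableLatticeReduction

variable {G : Type*} [Monoid G] {A : Type*} [AddCommGroup A] {p : ℕ}

/-! ### §1. Powers of an equivariant endomorphism and their kernels -/

section Powers

variable {F : Type u} [AddCommGroup F] (ρ : Representation ℤ G F) (T : F →ₗ[ℤ] F)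

/-- The powers of a `G`-equivariant endomorphism are `G`-equivariant (the operators `(t-1)^i` of
Serre's filtration commute with the group). [cite: Serre1979, IX §1 Thm. 2, Corollary] -/
theorem pow_apply_comm (hT : ∀ s x, T (ρ s x) = ρ s (T x)) (i : ℕ) (s : G) (x : F) :
    (T ^ i) (ρ s x) = ρ s ((T ^ i) x) := by
  induction i generalizing x with
  | zero => rw [pow_zero, Module.End.one_apply, Module.End.one_apply]
  | succ i ih => rw [pow_succ, Module.End.mul_apply, Module.End.mul_apply, hT, ih]

/-- The kernels `K_i = ker (T ^ i)` of a `G`-equivariant endomorphism are `G`-stable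
(subrepresentations). [cite: Serre1979, IX §1 Thm. 2, Corollary] -/
theorem ker_pow_le_comap (hT : ∀ s x, T (ρ s x) = ρ s (T x)) (i : ℕ) (s : G) :
    LinearMap.ker (T ^ i) ≤ (LinearMap.ker (T ^ i)).comap (ρ s) :=
  ker_le_comap_of_comm ρ ρ (T ^ i) (pow_apply_comm ρ T hT i) s

omit ρ in
/-- `T` maps `K_{i+1} = ker (T ^ (i+1))` into `K_i = ker (T ^ i)` (the graded structure of the
filtration). [cite: Serre1979, IX §1 Thm. 2, Corollary] -/
theorem map_mem_ker_pow (i : ℕ) (x : F) (hx : x ∈ LinearMap.ker (T ^ (i + 1))) :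
    T x ∈ LinearMap.ker (T ^ i) := by
  rw [LinearMap.mem_ker] at hx ⊢
  rwa [pow_succ, Module.End.mul_apply] at hx

omit ρ in
/-- The kernel of `T : ker (T ^ (i+1)) → ker (T ^ i)` is `ker T`, re-ambiented.
[folklore] -/
private theorem ker_restrict_eq (i : ℕ) :
    LinearMap.ker (T.restrict (map_mem_ker_pow T i)) =
      (LinearMap.ker T).comap (LinearMap.ker (T ^ (i + 1))).subtype := by
  ext x
  rw [LinearMap.mem_ker, Submodule.mem_comap, LinearMap.mem_ker, Submodule.coe_subtype]
  constructor
  · intro h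
    have h' := congrArg Subtype.val h
    rwa [LinearMap.restrict_apply] at h'
  · intro h
    exact Subtype.ext (by rw [LinearMap.restrict_apply]; exact h)

omit ρ in
/-- `ker T ≤ ker (T ^ (i+1))`. [folklore] -/
private theorem ker_le_ker_pow_succ (i : ℕ) : LinearMap.ker T ≤ LinearMap.ker (T ^ (i + 1)) := by
  intro x hx
  rw [LinearMap.mem_ker] at hx ⊢
  rw [pow_succ, Module.End.mul_apply, hx, map_zero]

omit ρ in
/-- `ker (T ^ 0) = ⊥`. [folklore] -/
private theorem ker_pow_zero : LinearMap.ker (T ^ 0) = ⊥ := by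
  rw [pow_zero]; exact LinearMap.ker_id

omit ρ in
/-- `ker (T ^ n) = ⊤` when `T ^ n = 0`. [folklore] -/
private theorem ker_pow_eq_top {n : ℕ} (hTn : T ^ n = 0) : LinearMap.ker (T ^ n) = ⊤ := by
  rw [hTn]; exact LinearMap.ker_zero

end Powers

/-! ### §2. Counting: `#ker(T^(i+1)) = #ker T · #T(ker T^(i+1))`, and surjectivity -/

section Counting

variable {F : Type u} [AddCommGroup F] [Finite F] (T : F →ₗ[ℤ] F)

omit [Finite F] in
/-- `#ker (T ^ (i+1)) = #ker T · #range (T|ker T^(i+1))`. [folklore] -/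
private theorem card_ker_pow_succ (i : ℕ) :
    Nat.card (LinearMap.ker (T ^ (i + 1))) =
      Nat.card (LinearMap.ker T) *
        Nat.card (LinearMap.range (T.restrict (map_mem_ker_pow T i))) := by
  set φ := T.restrict (map_mem_ker_pow T i) with hφ
  rw [Submodule.card_eq_card_quotient_mul_card (LinearMap.ker φ),
    Nat.card_congr φ.quotKerEquivRange.toEquiv, ker_restrict_eq T i,
    Nat.card_congr (Submodule.comapSubtypeEquivOfLe (ker_le_ker_pow_succ T i)).toEquiv, mul_comm]

/-- `#ker (T ^ (i+1)) ≤ #ker T · #ker (T ^ i)`. [folklore] -/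
private theorem card_ker_pow_succ_le (i : ℕ) :
    Nat.card (LinearMap.ker (T ^ (i + 1))) ≤
      Nat.card (LinearMap.ker T) * Nat.card (LinearMap.ker (T ^ i)) := by
  rw [card_ker_pow_succ T i]
  exact Nat.mul_le_mul_left _
    (Nat.card_le_card_of_injective (LinearMap.range (T.restrict (map_mem_ker_pow T i))).subtype
      (Submodule.subtype_injective _))

/-- `#ker (T ^ i) ≤ (#ker T) ^ i`. [folklore] -/
private theorem card_ker_pow_le (i : ℕ) :
    Nat.card (LinearMap.ker (T ^ i)) ≤ Nat.card (LinearMap.ker T) ^ i := by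
  induction i with
  | zero => rw [ker_pow_zero, pow_zero]; exact (Nat.card_unique (α := (⊥ : Submodule ℤ F))).le
  | succ i ih =>
    exact (card_ker_pow_succ_le T i).trans (by rw [pow_succ']; exact Nat.mul_le_mul_left _ ih)

/-- If `T ^ n = 0` and `#F = (#ker T)^n` then `#ker (T ^ i) = (#ker T)^i` for all `i ≤ n`
(the chain of inequalities `#F = #Kₙ ≤ #K₁·#Kₙ₋₁ ≤ ⋯ ≤ #K₁ⁿ = #F` is an equality throughout).
[cite: Serre1979, IX §1 Thm. 2, Corollary] -/
theorem card_ker_pow_eq {n : ℕ} (hTn : T ^ n = 0)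
    (hcard : Nat.card F = Nat.card (LinearMap.ker T) ^ n) :
    ∀ i, i ≤ n → Nat.card (LinearMap.ker (T ^ i)) = Nat.card (LinearMap.ker T) ^ i := by
  have hpos : 0 < Nat.card (LinearMap.ker T) := Nat.card_pos
  -- downward induction on `j = n - i`
  suffices h : ∀ j, j ≤ n → Nat.card (LinearMap.ker (T ^ (n - j))) =
      Nat.card (LinearMap.ker T) ^ (n - j) by
    intro i hi
    have := h (n - i) (Nat.sub_le n i)
    rwa [Nat.sub_sub_self hi] at this
  intro j
  induction j with
  | zero =>
    intro _
    rw [Nat.sub_zero, ker_pow_eq_top T hTn, ← hcard]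
    exact Nat.card_congr (Submodule.topEquiv.toEquiv)
  | succ j ih =>
    intro hj
    have hj' : j ≤ n := Nat.le_of_succ_le hj
    have hsucc : n - j = (n - (j + 1)) + 1 := by omega
    have htop := ih hj'
    rw [hsucc] at htop
    -- `#K₁^(m+1) = #K(m+1) ≤ #K₁·#K m ≤ #K₁·#K₁^m`
    set m := n - (j + 1) with hm
    have h1 := card_ker_pow_succ_le T m
    have h2 := card_ker_pow_le T m
    rw [htop, pow_succ'] at h1
    refine le_antisymm h2 ?_
    exact Nat.le_of_mul_le_mul_left h1 hpos

/-- Under `T ^ n = 0` and `#F = (#ker T)^n`, the map `T : ker (T ^ (i+1)) → ker (T ^ i)` is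
SURJECTIVE for every `i < n`. [cite: Serre1979, IX §1 Thm. 2, Corollary] -/
theorem restrict_surjective {n : ℕ} (hTn : T ^ n = 0)
    (hcard : Nat.card F = Nat.card (LinearMap.ker T) ^ n) (i : ℕ) (hi : i < n) :
    Surjective (T.restrict (map_mem_ker_pow T i)) := by
  have hpos : 0 < Nat.card (LinearMap.ker T) := Nat.card_pos
  have hi1 := card_ker_pow_eq T hTn hcard (i + 1) hi
  have hi0 := card_ker_pow_eq T hTn hcard i hi.le
  have key : Nat.card (LinearMap.ker T) *
        Nat.card (LinearMap.range (T.restrict (map_mem_ker_pow T i))) =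
      Nat.card (LinearMap.ker T) * Nat.card (LinearMap.ker (T ^ i)) := by
    rw [← card_ker_pow_succ T i, hi1, hi0, pow_succ']
  have hr : Nat.card (LinearMap.range (T.restrict (map_mem_ker_pow T i))) =
      Nat.card (LinearMap.ker (T ^ i)) := Nat.eq_of_mul_eq_mul_left hpos key
  rw [← LinearMap.range_eq_top]
  refine SetLike.coe_injective (Set.Finite.eq_of_subset_of_card_le (Set.toFinite _)
    (fun x _ => Submodule.mem_top (x := x)) ?_)
  have e1 : Nat.card ((⊤ : Submodule ℤ (LinearMap.ker (T ^ i))) : Set (LinearMap.ker (T ^ i))) =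
      Nat.card (LinearMap.ker (T ^ i)) := by
    rw [Submodule.top_coe, Nat.card_univ]
  have e2 : Nat.card ((LinearMap.range (T.restrict (map_mem_ker_pow T i)) :
      Set (LinearMap.ker (T ^ i)))) =
        Nat.card (LinearMap.range (T.restrict (map_mem_ker_pow T i))) := rfl
  rw [e1, e2, hr]

end Counting

/-! ### §3. The additive invariant along the kernel filtration -/

section Additive

variable (ψ : ∀ ⦃X : Type u⦄ [AddCommGroup X] [Module ℤ X], Representation ℤ G X → A)
  (hψ : ∀ ⦃X Y Z : Type u⦄ [AddCommGroup X] [Module ℤ X] [AddCommGroup Y] [Module ℤ Y]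
    [AddCommGroup Z] [Module ℤ Z] (ρX : Representation ℤ G X) (ρY : Representation ℤ G Y)
    (ρZ : Representation ℤ G Z) (f : X →ₗ[ℤ] Y) (g : Y →ₗ[ℤ] Z),
    (∀ s x, f (ρX s x) = ρY s (f x)) → (∀ s y, g (ρY s y) = ρZ s (g y)) →
    Injective f → Surjective g → LinearMap.range f = LinearMap.ker g → Finite Y →
    (∀ y : Y, (p : ℤ) • y = 0) → ψ ρY = ψ ρX + ψ ρZ)
include hψ

variable {F : Type u} [AddCommGroup F] [Finite F] (ρ : Representation ℤ G F)
  (hpF : ∀ x : F, (p : ℤ) • x = 0) (T : F →ₗ[ℤ] F) (hT : ∀ s x, T (ρ s x) = ρ s (T x))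
include hpF hT

/-- One step: `ψ (ker T^(i+1)) = ψ (ker T) + ψ (ker T^i)` when `T : ker T^(i+1) → ker T^i` is
surjective. [cite: MilneADT2006, I Lemma 2.10 (p. 32)] [cite: Serre1979, IX §1 Thm. 2, Corollary] -/
theorem additive_ker_pow_succ (i : ℕ) (hsurj : Surjective (T.restrict (map_mem_ker_pow T i))) :
    ψ (ρ.subrepresentation (LinearMap.ker (T ^ (i + 1))) (ker_pow_le_comap ρ T hT (i + 1))) =
      ψ (ρ.subrepresentation (LinearMap.ker T) (ker_le_comap_of_comm ρ ρ T hT)) +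
        ψ (ρ.subrepresentation (LinearMap.ker (T ^ i)) (ker_pow_le_comap ρ T hT i)) := by
  obtain ⟨good_sub, good_quot, hψ'⟩ := StableLatticeReduction.Int.admissible ψ hψ
  have hgoodF : Finite F ∧ ∀ x : F, (p : ℤ) • x = 0 := ⟨‹_›, hpF⟩
  have hgood1 := good_sub ρ _ (ker_pow_le_comap ρ T hT (i + 1)) hgoodF
  -- split along the surjection `T : K(i+1) ↠ K i`
  have hφ : ∀ s (y : LinearMap.ker (T ^ (i + 1))),
      T.restrict (map_mem_ker_pow T i) (ρ.subrepresentation _ (ker_pow_le_comap ρ T hT (i + 1)) s y) =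
        ρ.subrepresentation _ (ker_pow_le_comap ρ T hT i) s (T.restrict (map_mem_ker_pow T i) y) :=
    fun s y => Subtype.ext (by
      simp only [LinearMap.restrict_apply, Representation.subrepresentation_apply,
        LinearMap.restrict_apply]
      exact hT s y)
  rw [Admissible.additive_eq_ker_add_of_surjective ψ _ hψ' _ _ hgood1 _ hφ hsurj]
  congr 1
  -- the kernel of the restricted map is `ker T`, re-ambiented in `K(i+1)`
  haveI : Finite (LinearMap.ker T) := inferInstance
  have hgoodK : Finite (LinearMap.ker T) ∧ ∀ x : LinearMap.ker T, (p : ℤ) • x = 0 :=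
    good_sub ρ _ (ker_le_comap_of_comm ρ ρ T hT) hgoodF
  refine Admissible.additive_eq_of_linearEquiv ψ _ good_quot hψ' _ _ hgoodK
    ((LinearEquiv.ofEq _ _ (ker_restrict_eq T i)).trans
      (Submodule.comapSubtypeEquivOfLe (ker_le_ker_pow_succ T i))) (fun s x => rfl)

/-- `ψ (ker T^i) = i • ψ (ker T)` for `i ≤ n`, under `T ^ n = 0` and `#F = (#ker T)^n`.
[cite: MilneADT2006, I Lemma 2.10 (p. 32)] [cite: Serre1979, IX §1 Thm. 2, Corollary] -/
theorem additive_ker_pow_eq_smul {n : ℕ} (hTn : T ^ n = 0)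
    (hcard : Nat.card F = Nat.card (LinearMap.ker T) ^ n) :
    ∀ i, i ≤ n →
      ψ (ρ.subrepresentation (LinearMap.ker (T ^ i)) (ker_pow_le_comap ρ T hT i)) =
        i • ψ (ρ.subrepresentation (LinearMap.ker T) (ker_le_comap_of_comm ρ ρ T hT)) := by
  obtain ⟨good_sub, good_quot, hψ'⟩ := StableLatticeReduction.Int.admissible ψ hψ
  intro i
  induction i with
  | zero =>
    intro _
    rw [zero_smul]
    haveI : Subsingleton (LinearMap.ker (T ^ 0)) := by
      rw [ker_pow_zero]; infer_instance
    exact Admissible.additive_eq_zero_of_subsingleton ψ _ hψ' _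
      (good_sub ρ _ (ker_pow_le_comap ρ T hT 0) ⟨‹_›, hpF⟩)
  | succ i ih =>
    intro hi
    rw [additive_ker_pow_succ ψ hψ ρ hpF T hT i
        (restrict_surjective T hTn hcard i (Nat.lt_of_succ_le hi)),
      ih (Nat.le_of_succ_le hi), add_comm, succ_nsmul]

/-- **The counting form of the uniserial filtration.**  For a finite `ℤ[G]`-module `F` killed by
`p`, a `G`-equivariant endomorphism `T` with `T ^ n = 0` and `Nat.card F = (Nat.card (ker T)) ^ n`,
and any invariant `ψ` additive on short exact sequences of finite `p`-torsion `ℤ[G]`-modules: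
`ψ F = n • ψ (ker T)`. [cite: MilneADT2006, I Lemma 2.10 (p. 32) and proof of Thm. 5.1 (p. 70)]
[cite: Serre1979, IX §1 Thm. 2, Corollary] -/
theorem additive_eq_smul_of_pow_eq_zero_of_card {n : ℕ} (hTn : T ^ n = 0)
    (hcard : Nat.card F = Nat.card (LinearMap.ker T) ^ n) :
    ψ ρ = n • ψ (ρ.subrepresentation (LinearMap.ker T) (ker_le_comap_of_comm ρ ρ T hT)) := by
  obtain ⟨good_sub, good_quot, hψ'⟩ := StableLatticeReduction.Int.admissible ψ hψ
  rw [← additive_ker_pow_eq_smul ψ hψ ρ hpF T hT hTn hcard n le_rfl]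
  -- `F ≃ ker (T ^ n) = ⊤`
  refine Admissible.additive_eq_of_linearEquiv ψ _ good_quot hψ' _ _
    (good_sub ρ _ (ker_pow_le_comap ρ T hT n) ⟨‹_›, hpF⟩)
    (Submodule.topEquiv.symm.trans (LinearEquiv.ofEq _ _ (ker_pow_eq_top T hTn).symm))
    (fun s x => rfl)

end Additive

end KernelFiltration

end Literature.RepresentationTheory.FiniteGroups
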